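import Literature.Computability.MetaComplexity.AvgCaseCertifiedHardness
import Literature.Computability.Complexity.DensePropertySearch
import Literature.Computability.Complexity.ExpTimeMaps
import Literature.Computability.Complexity.SplitOnesBricks
import Literature.Computability.Complexity.FPStringBricks
import Literature.Computability.Complexity.PairPlumbing
import Literature.Computability.Complexity.CircuitClasses
import HarnessLib

/-!
# A `2^{εn}`-hard language in `E` from certified hard truth tables under `pr-BPP = pr-P` (Köbler–Schuler + Goldreich)

Topic `Literature/Computability/MetaComplexity`, companion to `AvgCaseCertifiedHardness.lean` (the
Köbler–Schuler certifier of hard truth tables under Hirahara's hypothesis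
`coNP × {U, T} ⊆ Avg¹_{1-n^{-c}} P`, in particular under `DistNP ⊆ AvgP`) and to
`Complexity/DensePropertySearch.lean` (finding an element of a dense polynomial-time decidable set under
`PromiseBPP' ⊆ PromiseP`). Putting the two together:

* `HardEFromCert.exists_hard_E_of_certifier_of_PromiseBPP'_subset` — from ANY polynomial-time certifier
  `A(w; 1ⁿ)` that accepts only truth tables of `B₂`-circuit complexity `> 2^{⌊ℓ/4⌋}` (at length
  `n = 2^ℓ`) and accepts a random table of every large length with probability `≥ 1/(2 (2^ℓ)^c)`, and
  `PromiseBPP' ⊆ PromiseP`, a language `L ∈ E` with `circuitSize(L, ℓ) > 2^{⌊ℓ/4⌋}` for all large `ℓ`,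
  hence `≥ 2^{ℓ/5}`: the finder of `DensePropertySearch.lean` run on `1^{2^ℓ}` outputs, in time
  `poly(2^ℓ)`, a CERTIFIED table `w_ℓ` (`table`, `good_table`); the language whose slice at length `ℓ`
  has truth table `w_ℓ` (`hardLang`: read bit `⟦y⟧` of `w_{|y|}`, through the linear-exponential pad
  `lpad 1` of `ExpTimeMaps.lean`) is in `E` (`hardLang_mem_E`, `preimage_mem_E`) and its slices are the
  tables (`truthTable_sliceFn`);
* **`Hirahara2021_hardE_of_Avg1P_of_PromiseBPP'_subset`** — under Hirahara's hypothesis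
  `coNP × {U, T} ⊆ Avg¹_{1-n^{-c}} P` (certifier `Hirahara2021_exists_certifier_of_Avg1P`) and
  `PromiseBPP' ⊆ PromiseP` there are `L ∈ E` and `ε > 0` with `circuitSize(L, n) ≥ 2^{εn}` for all
  large `n`;
* **`exists_hard_E_of_DistNP_subset_AvgP_of_PromiseBPP'_subset`** — the same under `DistNP ⊆ AvgP`
  and `PromiseBPP' ⊆ PromiseP`.

So, under `DistNP ⊆ AvgP`, Buhrman–Fortnow–Pavan's conclusion `pr-BPP = pr-P` (their Thm. 3.1, the
tree's named fact `BuhrmanFortnowPavan2004_PromiseBPP'_subset_PromiseP`) already gives back the hard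
language in `E` that their PROOF of Thm. 3.1 passes through (Lemma 3.7 + [IKW02] + the a.e. hierarchy),
and with it the quick Nisan–Wigderson generator (`exists_isSizePseudorandom_of_avgHard_E`); this is what
lets Hirahara's Thm. 1.6 (1) rest on that named fact alone
(`Cryptography/AverageCaseProofs.lean`, `hirahara_UP_DistNP_of_BFP`). The combination is folklore-level
(Goldreich 2011, §3: "explicit constructions" under `pr-BPP = pr-P`; Köbler–Schuler 2004 / Hirahara 2021,
Lemma 3.4, item 2: the average-case hypothesis certifies hard tables); every statement here is proved.
No named fact is introduced (D-0026).

## References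

* O. Goldreich, *In a world of P = BPP*, LNCS 6650 (2011), §3.2, Thm. 3.5 (reducing BPP-search to
  decision) and §3.3, Prop. 3.8 (derandomizing constructions: "if BPP = P, then n-bit long primes can be
  found in deterministic poly(n)-time") [Goldreich2011].
* J. Köbler, R. Schuler, *Average-case intractability vs. worst-case intractability*, Inform. and Comput.
  190 (2004) 1–17 [KoblerSchuler2004]; S. Hirahara, ECCC TR21-058 (2021), Lemma 3.4, proof sketch,
  item 2 (p. 20) [Hirahara2021].
* H. Buhrman, L. Fortnow, A. Pavan, *Some results on derandomization*, Theory Comput. Syst. 38 (2005),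
  Thm. 3.1 and its proof [BuhrmanFortnowPavan2004].
* S. Arora, B. Barak, *Computational Complexity: A Modern Approach*, CUP 2009, §2.6.2 (`E`, padding),
  §6.1 (slices of a language), §20.1–20.2 (hard functions for generators) [AroraBarakCC2009].
-/

noncomputable section

namespace Literature.Computability.MetaComplexity

open _root_.Computability Polynomial Complexity Complexity.Classes Complexity.Nondeterministic Brick Plumb HashBricks Filter

namespace HardEFromCert

variable (A : List Bool → ℕ → Bool) (F : List Bool → List Bool)

/-! ### The certifier as a one-bit test -/

/-- **The certifier as a polynomial-time one-bit test** `w ↦ [A(w; 1^{|w|})]` (the table read at its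
own length parameter). [cite: Hirahara2021, Lemma 3.4 (proof sketch, item 2)] -/
def certG : List Bool → List Bool :=
  (fun w => encodeBool (A (boolUnpair w).1 (boolUnpair w).2.length)) ∘ copyFn

/-- Value of the test. [folklore] -/
@[simp] theorem certG_apply (w : List Bool) : certG A w = [A w w.length] := by
  simp [certG, copyFn_apply, encodeBool]

/-- The test is in `FP` for a polynomial-time certifier (`mem_FP_of_unaryArg` after `copyFn`). [folklore] -/
theorem certG_mem_FP (hA : PolyTimeComputable paramEnc encodeBool (Function.uncurry A)) : certG A ∈ FP :=
  comp_mem_FP (mem_FP_of_unaryArg hA) copyFn_mem_FP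

/-! ### The tables and the language reading them -/

/-- **The table of arity `ℓ`**: the finder's output on `1^{2^ℓ}`. [Goldreich 2011, §3] [folklore] -/
def table (ℓ : ℕ) : List Bool := F (ones (2 ^ ℓ))

/-- On `z = ⟨pad, y⟩`: the table `F (onesPrefix pad)` (for `pad = 1^{2^{|y|}} 0 1^{|y|}` this is
`table |y|`). [folklore] -/
def tabF : List Bool → List Bool := F ∘ onesPrefixFn ∘ fstF

/-- **The bit reader** `⟨pad, y⟩ ↦ [bit ⟦y⟧ of the table]` (index in unary by `binToUnaryFn` with the
table as ruler, then `drop` and `head`). [Arora–Barak 2009, §6.1] [folklore] -/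
def bitF : List Bool → List Bool :=
  headBitFn ∘ dropFn ∘ fanoutFn (binToUnaryFn ∘ fanoutFn (tabF F) sndF) (tabF F)

/-- The bit language (in `P` for `F ∈ FP`). [folklore] -/
def bitLang : Language Bool := {z | bitF F z = [true]}

/-- **The hard language**: `y ∈ L` iff bit `⟦y⟧` of `table |y|` is `1`, read through the
linear-exponential pad `lpad 1 y = ⟨1^{2^{|y|}} 0 1^{|y|}, y⟩`. [Arora–Barak 2009, §2.6.2 (padding)] [folklore] -/
def hardLang : Language Bool := lpad 1 ⁻¹' bitLang F

variable {A F}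

/-- The pad's first component splits as `1^{2^{|y|}} 0 1^{|y|}`. [folklore] -/
theorem fstF_lpad_one (y : List Bool) : fstF (lpad 1 y) = ones (2 ^ y.length) ++ false :: ones y.length := by
  simp [lpad, expPad, fstF, ones]

/-- Value of the table brick on a padded input. [folklore] -/
theorem tabF_lpad (y : List Bool) : tabF F (lpad 1 y) = table F y.length := by
  rw [tabF, Function.comp_apply, Function.comp_apply, fstF_lpad_one, onesPrefixFn_ones_append, table]

/-- **Value of the bit reader on a padded input**, for a length-preserving `F`. [folklore] -/
theorem bitF_lpad (hF : ∀ u, (F u).length = u.length) (y : List Bool) :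
    bitF F (lpad 1 y) = [(table F y.length).getD (bitsToNat y) false] := by
  have hlen : (table F y.length).length = 2 ^ y.length := by rw [table, hF]; simp [ones]
  have hidx : bitsToNat y < 2 ^ y.length := bitsToNat_lt y
  have hsnd : sndF (lpad 1 y) = y := by simp [lpad, sndF]
  simp only [bitF, Function.comp_apply, fanoutFn_apply, tabF_lpad, hsnd, binToUnaryFn_boolPair, hlen,
    min_eq_left hidx.le, dropFn_boolPair, ones, List.length_replicate, headBitFn_apply]
  rw [List.getD_eq_getElem?_getD, List.headD_eq_head?_getD, List.head?_drop]

/-- Membership in the hard language. [folklore] -/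
theorem mem_hardLang_iff (hF : ∀ u, (F u).length = u.length) (y : List Bool) :
    y ∈ hardLang F ↔ (table F y.length).getD (bitsToNat y) false = true := by
  change bitF F (lpad 1 y) = [true] ↔ _
  rw [bitF_lpad hF]
  simp

/-- `bitF ∈ FP` for `F ∈ FP`. [folklore] -/
theorem bitF_mem_FP (hFP : F ∈ FP) : bitF F ∈ FP := by
  have htab : tabF F ∈ FP := comp_mem_FP hFP (comp_mem_FP onesPrefixFn_mem_FP fstF_mem_FP)
  exact comp_mem_FP headBitFn_mem_FP (comp_mem_FP dropFn_mem_FP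
    (fanoutFn_mem_FP (comp_mem_FP binToUnaryFn_mem_FP (fanoutFn_mem_FP htab sndF_mem_FP)) htab))

/-- The bit language is in `P`. [folklore] -/
theorem bitLang_mem_P (hFP : F ∈ FP) : bitLang F ∈ Classes.P :=
  setOf_apply_eq_apply_mem_P (bitF_mem_FP hFP) (const_mem_FP _)

/-- **The hard language is in `E`** (a `P` language behind a `2^{O(n)}`-time pad, `preimage_mem_E`).
[Arora–Barak 2009, §2.6.2] [folklore] -/
theorem hardLang_mem_E (hFP : F ∈ FP) : hardLang F ∈ E :=
  preimage_mem_E (lpad_mem_FE 1) (bitLang_mem_P hFP)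

/-- The little-endian value of a listed bit vector is its `boolFunEquivFin` index (local copy of
`IKWExt.bitsToNat_ofFn`, not imported to keep this file light). [folklore] -/
private theorem bitsToNat_ofFn : ∀ {L : ℕ} (v : Fin L → Bool), bitsToNat (List.ofFn v) = (boolFunEquivFin L v).val
  | 0, v => by simp [boolFunEquivFin]
  | L + 1, v => by
    rw [List.ofFn_succ, bitsToNat_cons, bitsToNat_ofFn]
    change (v 0).toNat + 2 * ((finFunctionFinEquiv fun i : Fin L => finTwoEquiv.symm (v i.succ)) : ℕ) =
      ((finFunctionFinEquiv fun i : Fin (L + 1) => finTwoEquiv.symm (v i)) : ℕ)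
    rw [finFunctionFinEquiv_apply, finFunctionFinEquiv_apply, Fin.sum_univ_succ]
    simp only [Fin.val_zero, pow_zero, mul_one, Fin.val_succ, pow_succ]
    rw [Finset.mul_sum]
    congr 1
    · cases v 0 <;> rfl
    · exact Finset.sum_congr rfl fun i _ => by ring

/-- **The slices of the hard language are the tables**: `tt(L ∩ {0,1}^ℓ) = table ℓ`.
[Arora–Barak 2009, §6.1; Kabanets–Cai 2000, §2] [folklore] -/
theorem truthTable_sliceFn (hF : ∀ u, (F u).length = u.length) (ℓ : ℕ) :
    truthTable ((hardLang F).sliceFn ℓ) = table F ℓ := by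
  have hlen : (table F ℓ).length = 2 ^ ℓ := by rw [table, hF]; simp [ones]
  apply List.ext_getElem
  · rw [length_truthTable, hlen]
  · intro i h₁ h₂
    rw [length_truthTable] at h₁
    simp only [truthTable, List.getElem_ofFn, Language.sliceFn]
    have hval : bitsToNat (List.ofFn ((boolFunEquivFin ℓ).symm ⟨i, h₁⟩)) = i := by
      rw [bitsToNat_ofFn, Equiv.apply_symm_apply]
    have hmem := mem_hardLang_iff hF (List.ofFn ((boolFunEquivFin ℓ).symm ⟨i, h₁⟩))
    rw [List.length_ofFn, hval, List.getD_eq_getElem _ _ h₂] at hmem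
    by_cases h : List.ofFn ((boolFunEquivFin ℓ).symm ⟨i, h₁⟩) ∈ hardLang F
    · rw [(Set.mem_iff_boolIndicator _ _).1 h, ← hmem.1 h]
    · rw [(Set.notMem_iff_boolIndicator _ _).1 h]
      symm
      simpa using mt hmem.2 h

/-- **The slices of the hard language are hard where the tables are certified.** [folklore] -/
theorem circuitSize_hardLang (hF : ∀ u, (F u).length = u.length)
    (hsound : ∀ (ℓ : ℕ) (f : (Fin ℓ → Bool) → Bool), A (truthTable f) (2 ^ ℓ) = true → 2 ^ (ℓ / 4) < circuitSizeOver B2 f)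
    {ℓ : ℕ} (hgood : A (table F ℓ) (2 ^ ℓ) = true) : 2 ^ (ℓ / 4) < (hardLang F).circuitSize ℓ := by
  have h := hsound ℓ ((hardLang F).sliceFn ℓ)
  rw [truthTable_sliceFn hF] at h
  exact h hgood

/-! ### The tables are certified -/

/-- Local copy of `uniformProb` congruence. [folklore] -/
private theorem prob_congr {m : ℕ} {E E' : Set (List Bool)} (h : ∀ y : List Bool, y.length = m → (y ∈ E ↔ y ∈ E')) :
    uniformProb m E = uniformProb m E' := by
  rw [uniformProb_eq_cnt_div, uniformProb_eq_cnt_div, cnt_congr h]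

/-- The density slack of the finder is beaten by the certifier's abundance:
`2N/(4N^{c+1} + 1) < 1/(2N^c)` for `N ≥ 1`. [folklore] -/
theorem slack_lt (N c : ℕ) (hN : 1 ≤ N) :
    2 * (N : ℝ) / ((4 * X ^ (c + 1) : Polynomial ℕ).eval N + 1 : ℕ) < 1 / (2 * (N : ℝ) ^ c) := by
  have hN' : (0 : ℝ) < N := by exact_mod_cast hN
  have heval : (((4 * X ^ (c + 1) : Polynomial ℕ).eval N + 1 : ℕ) : ℝ) = 4 * (N : ℝ) ^ (c + 1) + 1 := by
    simp [eval_pow]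
  rw [heval, div_lt_div_iff₀ (by positivity) (by positivity), pow_succ]
  nlinarith [pow_pos hN' c]

/-- **The finder's tables are certified** at every large arity: on `1^{2^ℓ}` the good strings (those
accepted by `A`) have density `≥ 1/(2 (2^ℓ)^c) > 2·2^ℓ/(4 (2^ℓ)^{c+1} + 1)`, so the finder returns one of
them. [Goldreich 2011, §3 (Thm. 3.5)] [folklore] -/
theorem good_table {c ℓ₀ : ℕ}
    (habund : ∀ ℓ : ℕ, ℓ₀ ≤ ℓ → 1 / (2 * ((2 : ℝ) ^ ℓ) ^ c) ≤ uniformProb (2 ^ ℓ) {w | A w (2 ^ ℓ) = true})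
    (hF : ∀ u : List Bool, (F u).length = u.length ∧
      (2 * (u.length : ℝ) / ((4 * X ^ (c + 1) : Polynomial ℕ).eval u.length + 1 : ℕ) <
        uniformProb u.length {w | certG A w = [true]} → certG A (F u) = [true]))
    {ℓ : ℕ} (hℓ : ℓ₀ ≤ ℓ) : A (table F ℓ) (2 ^ ℓ) = true := by
  have hlenu : (ones (2 ^ ℓ)).length = 2 ^ ℓ := by simp [ones]
  obtain ⟨hlen, hgood⟩ := hF (ones (2 ^ ℓ))
  rw [hlenu] at hlen hgood
  have hdens : 2 * ((2 ^ ℓ : ℕ) : ℝ) / ((4 * X ^ (c + 1) : Polynomial ℕ).eval (2 ^ ℓ) + 1 : ℕ) <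
      uniformProb (2 ^ ℓ) {w | certG A w = [true]} := by
    refine (slack_lt (2 ^ ℓ) c Nat.one_le_two_pow).trans_le ?_
    have h := habund ℓ hℓ
    push_cast at h ⊢
    refine h.trans_eq (prob_congr fun w hw => ?_)
    simp only [Set.mem_setOf_eq, certG_apply, hw, List.cons.injEq, and_true]
  have h := hgood hdens
  rw [certG_apply, hlen] at h
  simpa [table] using h

/-! ### Main statements -/

/-- **A hard language in `E` from a certifier of hard tables, under `PromiseBPP' ⊆ PromiseP`.** Given a
polynomial-time certifier `A(w; 1ⁿ)` accepting only truth tables of `B₂`-circuit complexity `> 2^{⌊ℓ/4⌋}`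
(at length `2^ℓ`) and accepting a random table of length `2^ℓ` with probability `≥ 1/(2 (2^ℓ)^c)` for
`ℓ ≥ ℓ₀`, and `PromiseBPP' ⊆ PromiseP`, there is `L ∈ E` with `circuitSize(L, ℓ) > 2^{⌊ℓ/4⌋}` for all
`ℓ ≥ ℓ₀`. [Goldreich 2011, §3.3, Prop. 3.8 with §3.2, Thm. 3.5; Hirahara 2021, Lemma 3.4 (proof sketch, item 2)] [folklore] -/
theorem exists_hard_E_of_certifier_of_PromiseBPP'_subset (hBPP : PromiseBPP' ⊆ PromiseP)
    {A : List Bool → ℕ → Bool} {c ℓ₀ : ℕ} (hA : PolyTimeComputable paramEnc encodeBool (Function.uncurry A))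
    (hsound : ∀ (ℓ : ℕ) (f : (Fin ℓ → Bool) → Bool), A (truthTable f) (2 ^ ℓ) = true → 2 ^ (ℓ / 4) < circuitSizeOver B2 f)
    (habund : ∀ ℓ : ℕ, ℓ₀ ≤ ℓ → 1 / (2 * ((2 : ℝ) ^ ℓ) ^ c) ≤ uniformProb (2 ^ ℓ) {w | A w (2 ^ ℓ) = true}) :
    ∃ L ∈ E, ∀ ℓ : ℕ, ℓ₀ ≤ ℓ → 2 ^ (ℓ / 4) < L.circuitSize ℓ := by
  obtain ⟨F, hFP, hF⟩ := DenseSearch.exists_finder_of_PromiseBPP'_subset hBPP (certG_mem_FP A hA) (4 * X ^ (c + 1))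
  have hlen : ∀ u, (F u).length = u.length := fun u => (hF u).1
  exact ⟨hardLang F, hardLang_mem_E hFP, fun ℓ hℓ => circuitSize_hardLang hlen hsound (good_table habund hF hℓ)⟩

/-- From `circuitSize > 2^{⌊n/4⌋}` at all large `n` to the `2^{εn}` form with `ε = 1/5`. [folklore] -/
theorem eventually_rpow_le_of_quarter {L : Language Bool} {ℓ₀ : ℕ} (h : ∀ ℓ : ℕ, ℓ₀ ≤ ℓ → 2 ^ (ℓ / 4) < L.circuitSize ℓ) :
    ∀ᶠ n : ℕ in atTop, (2 : ℝ) ^ ((1 / 5 : ℝ) * n) ≤ (L.circuitSize n : ℝ) := by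
  refine Filter.eventually_atTop.2 ⟨max ℓ₀ 20, fun n hn => ?_⟩
  have hn0 : ℓ₀ ≤ n := le_of_max_le_left hn
  have hn20 : 20 ≤ n := le_of_max_le_right hn
  have h1 : (1 / 5 : ℝ) * n ≤ ((n / 4 : ℕ) : ℝ) := by
    have h4 : 4 * (n / 4) + 4 > n := by omega
    have h5 : (n : ℝ) < 4 * ((n / 4 : ℕ) : ℝ) + 4 := by exact_mod_cast h4
    have h6 : (20 : ℝ) ≤ n := by exact_mod_cast hn20
    linarith
  calc (2 : ℝ) ^ ((1 / 5 : ℝ) * n) ≤ (2 : ℝ) ^ (((n / 4 : ℕ) : ℝ)) := Real.rpow_le_rpow_of_exponent_le one_le_two h1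
    _ = ((2 ^ (n / 4) : ℕ) : ℝ) := by rw [Real.rpow_natCast]; push_cast; ring
    _ ≤ (L.circuitSize n : ℝ) := by exact_mod_cast (h n hn0).le

/-- **Hirahara 2021, Lemma 3.4, items 1–3 with `pr-BPP = pr-P` in place of item 3's PCPs**: under
Hirahara's hypothesis `coNP × {U, T} ⊆ Avg¹_{1-n^{-c}} P` and `PromiseBPP' ⊆ PromiseP` there are `L ∈ E`
and `ε > 0` with `circuitSize(L, n) ≥ 2^{εn}` for all large `n` — the Köbler–Schuler certifier
(`Hirahara2021_exists_certifier_of_Avg1P`) made into an explicit construction by the derandomised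
greedy search (`exists_hard_E_of_certifier_of_PromiseBPP'_subset`).
[cite: Hirahara2021, Lemma 3.4 (proof sketch, items 1–3, p. 20)] [cite: Goldreich2011, §3.3, Prop. 3.8 (with §3.2, Thm. 3.5)] -/
theorem Hirahara2021_hardE_of_Avg1P_of_PromiseBPP'_subset
    (hyp : ∃ c : ℕ, distClass coNP {uniformEnsemble, tallyEnsemble} ⊆ Avg1DeltaP fun n => 1 - 1 / (n : ℝ) ^ c)
    (hBPP : PromiseBPP' ⊆ PromiseP) :
    ∃ L ∈ E, ∃ ε : ℝ, 0 < ε ∧ ∀ᶠ n : ℕ in atTop, (2 : ℝ) ^ (ε * n) ≤ (L.circuitSize n : ℝ) := by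
  obtain ⟨A, c, ℓ₀, hA, hsound, habund, -⟩ := Hirahara2021_exists_certifier_of_Avg1P hyp
  obtain ⟨L, hL, hhard⟩ := exists_hard_E_of_certifier_of_PromiseBPP'_subset hBPP hA hsound habund
  exact ⟨L, hL, 1 / 5, by norm_num, eventually_rpow_le_of_quarter hhard⟩

/-- **Under `DistNP ⊆ AvgP`, `pr-BPP = pr-P` gives a `2^{εn}`-hard language in `E`** (so that, under
`DistNP ⊆ AvgP`, Buhrman–Fortnow–Pavan's Thm. 3.1 and "`E ⊄ i.o.SIZE(2^{εn})` for some `ε > 0`" are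
equivalent; the converse is Impagliazzo–Wigderson + Nisan–Wigderson, `PromiseBPP'_subset_PromiseP_of_avgHard_E`).
[cite: BuhrmanFortnowPavan2004, Thm. 3.1 (proof)] [cite: Goldreich2011, §3.3, Prop. 3.8 (with §3.2, Thm. 3.5)]
[cite: Hirahara2021, Lemma 3.4 (proof sketch, p. 20)] -/
theorem exists_hard_E_of_DistNP_subset_AvgP_of_PromiseBPP'_subset (hD : DistNP ⊆ AvgP)
    (hBPP : PromiseBPP' ⊆ PromiseP) :
    ∃ L ∈ E, ∃ ε : ℝ, 0 < ε ∧ ∀ᶠ n : ℕ in atTop, (2 : ℝ) ^ (ε * n) ≤ (L.circuitSize n : ℝ) :=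
  Hirahara2021_hardE_of_Avg1P_of_PromiseBPP'_subset
    ⟨1, distClass_coNP_subset_Avg1DeltaP_of_DistNP_subset_AvgP hD one_ne_zero⟩ hBPP

end HardEFromCert

end Literature.Computability.MetaComplexity

end
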